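import Summits.Ventures.HSemireg.WedgeHankelClassSpaceSl2Triple

/-!
# Venture HSemireg — IRREDUCIBILITY AND SCHUR FOR THE INFINITESIMAL SUBSTITUTIONS: when `n!` is a unit, `ker e = K·E_n`, a non-zero subspace of th-7's class space stable
# under the raising operator `e` contains `E_n`, one stable under `e` and the lowering operator `f` is everything (`f^k E_n = k!·E_{n−k}`), and an endomorphism
# commuting with `e` and `f` is a scalar — the Lie-algebra form of J9 / J13 (shear + swap)

HONEST FRAMING. Part of the Lean index of the computation cell `pub-hsemireg` (seat p10 gen 22, Sunday typer «UNIFORM-IN-n»).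
Finite-dimensional EXTERIOR ALGEBRA + linear algebra ONLY: no variety, no cohomology theory, no sheaf, no Ext group, no semiregularity map;
nothing here says that HC / HC_CM / HC_AV holds; no Literature fact is declared or used.  Custodian versions as in `WedgeHankelSiegelIdeal` (1/3) and `WedgeHankelFrameChange`;
the dictionary (`Sym^n` is an irreducible `sl₂`-module with scalar commutant when `n!` is invertible) is QUOTED, never asserted.

WHAT IS IN THE TREE.  K27 (`WedgeHankelClassSpaceSl2Triple`): `e f` given on the spikes (`hE`, `hEtop`, `hF`; `f E_0 = 0` is not needed here), `pow_raising_spikeBasis_of_le` / `_eq_zero`,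
`raising_pow_succ_eq_zero` (`e^{n+1} = 0`), `raising_apply_of_not_lt`, `lowering_apply_of_not_pos`; J9 (`…ClassSpaceIrreducible`): `exists_mem_ker_of_nilpotent_stable`,
`pow_apply_mem_of_forall_mem`, and the GROUP version (shear + swap, `n! ≠ 0`); J13 / K9: Schur for shear + swap / torus + shear.  THIS FILE (namespace
`Summit.Ventures.HSemireg.Wedge.HankelFrameChange` continued; imports K27):
* §344 `repr_raising_apply_succ` (`repr (e v) (i+1) = (i+1)·repr v i`), **`mem_span_top_of_raising_eq_zero`** (`i + 1 ≠ 0` in `K` for `i < n` ⇒ `ker e ≤ K·E_n`),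
  **`spike_top_mem_of_raising_stable`** (`n! ≠ 0`: an `e`-stable `W ≠ ⊥` contains `E_n`), `pow_lowering_spike_top` (`f^k E_n = k! • E_{n−k}`), `factorial_cast_ne_zero_of_le`,
  **`spike_mem_of_lowering_stable`** (`E_n ∈ W`, `f`-stable, `n! ≠ 0` ⇒ every `E_i ∈ W`), **`eq_top_of_raising_lowering_stable`** (IRREDUCIBLE under `e`, `f` when `n! ≠ 0`),
  `…_charZero`.
* §345 SCHUR: `apply_spike_top_mem_span_of_commute_raising`, **`eq_smul_one_of_commute_raising_lowering`** (`φe = eφ`, `φf = fφ`, `n! ≠ 0` ⇒ `φ = c • 1`), `…_charZero`.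
NOT typed here: characteristic `p ≤ n` (the Siegel classes are `e`- and `f`-stable); the commutant of `e` alone; anything Ext-side.  New names only.
-/

open Module

namespace Summit.Ventures.HSemireg.Wedge.HankelFrameChange

open Summit.Ventures.HSemireg.Wedge Summit.Ventures.HSemireg.Wedge.Kunneth Summit.Ventures.HSemireg.Wedge.Hankel
  Summit.Ventures.HSemireg.Wedge.BasisFree Summit.Ventures.HSemireg.Wedge.HankelSiegel Summit.Ventures.HSemireg.Wedge.HankelSiegelIdeal
  Summit.Ventures.HSemireg.Wedge.KunnethKernel Summit.Ventures.HSemireg.Wedge.HankelRankOne Summit.Ventures.HSemireg.Wedge.KernelDuality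

variable (K : Type*) [Field K] {n : ℕ}

section Irred

variable {e f : Module.End K (spikeSpan K n)}
  (hE : ∀ (i : Fin (n + 1)) (hi : (i : ℕ) < n), e (spikeBasis K n i) = (((i : ℕ) : K) + 1) • spikeBasis K n ⟨(i : ℕ) + 1, by omega⟩) (hEtop : e (spikeBasis K n (Fin.last n)) = 0)
  (hF : ∀ (i : Fin (n + 1)) (hi : 0 < (i : ℕ)), f (spikeBasis K n i) = ((n : K) - (i : ℕ) + 1) • spikeBasis K n ⟨(i : ℕ) - 1, by omega⟩)

/-! ## §344. Irreducibility under `e` and `f` -/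

/-- `n! ≠ 0` in `K` ⇒ `i + 1 ≠ 0` in `K` for `i < n + 1`… precisely for `i + 1 ≤ n`. -/
theorem succ_cast_ne_zero_of_factorial (hfac : ((n.factorial : ℕ) : K) ≠ 0) {i : ℕ} (hi : i < n) : ((i : ℕ) : K) + 1 ≠ 0 := by
  intro h
  apply hfac
  obtain ⟨c, hc⟩ : i + 1 ∣ n.factorial := Nat.dvd_factorial (Nat.succ_pos i) (by omega)
  rw [hc, Nat.cast_mul, Nat.cast_succ, h, zero_mul]

include hE hEtop in
/-- **`repr (e v) (i+1) = (i+1) · repr v i`** (`i < n`): the raising operator shifts coordinates up with the factor `i + 1`. -/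
theorem repr_raising_apply_succ (v : spikeSpan K n) (i : Fin (n + 1)) (hi : (i : ℕ) < n) :
    (spikeBasis K n).repr (e v) ⟨(i : ℕ) + 1, by omega⟩ = (((i : ℕ) : K) + 1) * (spikeBasis K n).repr v i := by
  classical
  conv_lhs => rw [← (spikeBasis K n).sum_repr v]
  rw [map_sum, map_sum, Finsupp.finsetSum_apply]
  simp only [map_smul, Finsupp.smul_apply, smul_eq_mul]
  rw [Finset.sum_eq_single i]
  · rw [hE i hi, map_smul, Finsupp.smul_apply, Basis.repr_self, Finsupp.single_eq_same, smul_eq_mul, mul_one, mul_comm]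
  · intro j _ hj
    by_cases hj' : (j : ℕ) < n
    · rw [hE j hj', map_smul, Finsupp.smul_apply, Basis.repr_self, Finsupp.single_apply, if_neg, smul_zero, mul_zero]
      intro h
      exact hj (Fin.ext (by have := congrArg Fin.val h; simp only at this; omega))
    · rw [raising_apply_of_not_lt K hEtop j hj', map_zero, Finsupp.zero_apply, mul_zero]
  · intro h; exact absurd (Finset.mem_univ _) h

include hE hEtop in
/-- **`i + 1 ≠ 0` in `K` for every `i < n` (e.g. `n! ≠ 0`) ⇒ `ker e ≤ K·E_n`**: a class killed by the raising operator is a multiple of the point class. -/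
theorem mem_span_top_of_raising_eq_zero (hsucc : ∀ i : ℕ, i < n → ((i : ℕ) : K) + 1 ≠ 0) {v : spikeSpan K n} (hv : e v = 0) :
    v ∈ K ∙ spikeBasis K n (Fin.last n) := by
  have hc : ∀ i : Fin (n + 1), (i : ℕ) < n → (spikeBasis K n).repr v i = 0 := fun i hi => by
    have h := repr_raising_apply_succ K hE hEtop v i hi
    rw [hv, map_zero, Finsupp.zero_apply] at h
    exact (mul_eq_zero.mp h.symm).resolve_left (hsucc i hi)
  rw [Submodule.mem_span_singleton]
  refine ⟨(spikeBasis K n).repr v (Fin.last n), (spikeBasis K n).repr.injective (Finsupp.ext fun a => ?_)⟩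
  rw [map_smul, Finsupp.smul_apply, Basis.repr_self, Finsupp.single_apply, smul_eq_mul]
  by_cases ha : Fin.last n = a
  · rw [if_pos ha, mul_one, ha]
  · rw [if_neg ha, mul_zero, hc a (by have := a.2; have h2 : (a : ℕ) ≠ n := fun h => ha (Fin.ext (by rw [Fin.val_last, h])); omega)]

include hE hEtop in
/-- **`n! ≠ 0`: A NON-ZERO SUBSPACE STABLE UNDER THE RAISING OPERATOR CONTAINS THE POINT CLASS `E_n`** (`e` is nilpotent, so `W` meets `ker e = K·E_n` non-trivially; J9). -/
theorem spike_top_mem_of_raising_stable (hfac : ((n.factorial : ℕ) : K) ≠ 0) {W : Submodule K (spikeSpan K n)} (hW : ∀ v ∈ W, e v ∈ W) (hW0 : W ≠ ⊥) :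
    spikeBasis K n (Fin.last n) ∈ W := by
  obtain ⟨v, hvW, hv0, hev⟩ := exists_mem_ker_of_nilpotent_stable K (raising_pow_succ_eq_zero K hE hEtop) hW hW0
  obtain ⟨a, ha⟩ := Submodule.mem_span_singleton.mp (mem_span_top_of_raising_eq_zero K hE hEtop (fun i hi => succ_cast_ne_zero_of_factorial K hfac hi) hev)
  have ha0 : a ≠ 0 := fun h => hv0 (by rw [← ha, h, zero_smul])
  have h := W.smul_mem a⁻¹ hvW
  rwa [← ha, smul_smul, inv_mul_cancel₀ ha0, one_smul] at h

include hF in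
/-- **`f^k E_n = k! • E_{n−k}`** for `k ≤ n` (`f E_n = E_{n−1}`, `f E_{n−1} = 2E_{n−2}`, …). -/
theorem pow_lowering_spike_top {k : ℕ} (hk : k ≤ n) : (f ^ k) (spikeBasis K n (Fin.last n)) = ((k.factorial : ℕ) : K) • spikeBasis K n ⟨n - k, by omega⟩ := by
  induction k with
  | zero => rw [pow_zero, Module.End.one_apply, Nat.factorial_zero, Nat.cast_one, one_smul]; rfl
  | succ k ih =>
    rw [pow_succ', Module.End.mul_apply, ih (by omega), map_smul, hF ⟨n - k, by omega⟩ (by simp only; omega), smul_smul, Nat.factorial_succ, Nat.cast_mul]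
    have e2 : (⟨(((⟨n - k, by omega⟩ : Fin (n + 1)) : ℕ)) - 1, by simp only; omega⟩ : Fin (n + 1)) = ⟨n - (k + 1), by omega⟩ := Fin.ext (by simp only; omega)
    rw [e2]
    congr 1
    simp only [Nat.cast_sub (show k ≤ n by omega), Nat.cast_add, Nat.cast_one]
    ring

omit [Field K] in
/-- `n! ≠ 0` ⇒ `k! ≠ 0` in `K` for `k ≤ n`. -/
theorem factorial_cast_ne_zero_of_le (K : Type*) [Field K] (hfac : ((n.factorial : ℕ) : K) ≠ 0) {k : ℕ} (hk : k ≤ n) : ((k.factorial : ℕ) : K) ≠ 0 := by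
  intro h
  apply hfac
  obtain ⟨c, hc⟩ := Nat.factorial_dvd_factorial hk
  rw [hc, Nat.cast_mul, h, zero_mul]

include hF in
/-- **`n! ≠ 0`: a subspace containing `E_n` and stable under the lowering operator contains every spike** (`E_{n−k} = (k!)⁻¹ f^k E_n`). -/
theorem spike_mem_of_lowering_stable (hfac : ((n.factorial : ℕ) : K) ≠ 0) {W : Submodule K (spikeSpan K n)} (hW : ∀ v ∈ W, f v ∈ W)
    (htop : spikeBasis K n (Fin.last n) ∈ W) (i : Fin (n + 1)) : spikeBasis K n i ∈ W := by
  have hk : n - (i : ℕ) ≤ n := Nat.sub_le _ _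
  have h := pow_apply_mem_of_forall_mem K hW htop (n - (i : ℕ))
  rw [pow_lowering_spike_top K hF hk] at h
  have e1 : (⟨n - (n - (i : ℕ)), by omega⟩ : Fin (n + 1)) = i := Fin.ext (by have := i.2; simp only; omega)
  rw [e1] at h
  have h' := W.smul_mem ((((n - (i : ℕ)).factorial : ℕ) : K))⁻¹ h
  rwa [smul_smul, inv_mul_cancel₀ (factorial_cast_ne_zero_of_le K hfac hk), one_smul] at h'

include hE hEtop hF in
/-- **`n! ≠ 0`: TH-7's CLASS SPACE IS IRREDUCIBLE UNDER THE RAISING AND LOWERING OPERATORS** — every non-zero subspace stable under `e` and `f` is `⊤` (the Lie form of J9). -/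
theorem eq_top_of_raising_lowering_stable (hfac : ((n.factorial : ℕ) : K) ≠ 0) {W : Submodule K (spikeSpan K n)} (hWe : ∀ v ∈ W, e v ∈ W) (hWf : ∀ v ∈ W, f v ∈ W)
    (hW0 : W ≠ ⊥) : W = ⊤ := by
  rw [eq_top_iff, ← (spikeBasis K n).span_eq, Submodule.span_le]
  rintro _ ⟨i, rfl⟩
  exact spike_mem_of_lowering_stable K hF hfac hWf (spike_top_mem_of_raising_stable K hE hEtop hfac hWe hW0) i

include hE hEtop hF in
/-- characteristic `0`: irreducible under `e` and `f` for every `n`. -/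
theorem eq_top_of_raising_lowering_stable_charZero [CharZero K] {W : Submodule K (spikeSpan K n)} (hWe : ∀ v ∈ W, e v ∈ W) (hWf : ∀ v ∈ W, f v ∈ W) (hW0 : W ≠ ⊥) :
    W = ⊤ :=
  eq_top_of_raising_lowering_stable K hE hEtop hF (Nat.cast_ne_zero.mpr (Nat.factorial_ne_zero n)) hWe hWf hW0

/-! ## §345. Schur -/

include hE hEtop in
/-- an endomorphism commuting with `e` maps `E_n` into `ker e = K·E_n` (`i + 1 ≠ 0` for `i < n`). -/
theorem apply_spike_top_mem_span_of_commute_raising (hsucc : ∀ i : ℕ, i < n → ((i : ℕ) : K) + 1 ≠ 0) {φ : Module.End K (spikeSpan K n)} (hφ : φ * e = e * φ) :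
    φ (spikeBasis K n (Fin.last n)) ∈ K ∙ spikeBasis K n (Fin.last n) :=
  mem_span_top_of_raising_eq_zero K hE hEtop hsucc (by rw [← Module.End.mul_apply, ← hφ, Module.End.mul_apply, hEtop, map_zero])

include hE hEtop hF in
/-- **SCHUR FOR THE TRIPLE: `n! ≠ 0`, `φe = eφ`, `φf = fφ` ⇒ `φ = c • 1`** — `φ E_n = c E_n` (`ker e`), and `φ(f^k E_n) = f^k(φ E_n) = c f^k E_n` reaches every spike. -/
theorem eq_smul_one_of_commute_raising_lowering (hfac : ((n.factorial : ℕ) : K) ≠ 0) {φ : Module.End K (spikeSpan K n)} (hφe : φ * e = e * φ) (hφf : φ * f = f * φ) :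
    ∃ c : K, φ = c • 1 := by
  obtain ⟨c, hc⟩ := Submodule.mem_span_singleton.mp
    (apply_spike_top_mem_span_of_commute_raising K hE hEtop (fun i hi => succ_cast_ne_zero_of_factorial K hfac hi) hφe)
  refine ⟨c, (spikeBasis K n).ext fun i => ?_⟩
  have hk : n - (i : ℕ) ≤ n := Nat.sub_le _ _
  have hcomm : Commute φ f := hφf
  -- `E_i = (k!)⁻¹ • f^{n−i} E_n`, `k = n − i`
  have hfi : (f ^ (n - (i : ℕ))) (spikeBasis K n (Fin.last n)) = (((n - (i : ℕ)).factorial : ℕ) : K) • spikeBasis K n i := by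
    have e1 : (⟨n - (n - (i : ℕ)), by omega⟩ : Fin (n + 1)) = i := Fin.ext (by have := i.2; simp only; omega)
    rw [pow_lowering_spike_top K hF hk, e1]
  have hd := factorial_cast_ne_zero_of_le K hfac hk
  have hEi : spikeBasis K n i = ((((n - (i : ℕ)).factorial : ℕ) : K))⁻¹ • (f ^ (n - (i : ℕ))) (spikeBasis K n (Fin.last n)) := by
    rw [hfi, smul_smul, inv_mul_cancel₀ hd, one_smul]
  rw [LinearMap.smul_apply, Module.End.one_apply, hEi, map_smul, ← Module.End.mul_apply φ, (hcomm.pow_right _).eq, Module.End.mul_apply, ← hc, map_smul, smul_comm c]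

include hE hEtop hF in
/-- characteristic `0`: the commutant of `{e, f}` is the scalars. -/
theorem eq_smul_one_of_commute_raising_lowering_charZero [CharZero K] {φ : Module.End K (spikeSpan K n)} (hφe : φ * e = e * φ) (hφf : φ * f = f * φ) : ∃ c : K, φ = c • 1 :=
  eq_smul_one_of_commute_raising_lowering K hE hEtop hF (Nat.cast_ne_zero.mpr (Nat.factorial_ne_zero n)) hφe hφf

end Irred

end Summit.Ventures.HSemireg.Wedge.HankelFrameChange
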